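import Mathlib
import Summits.NavierStokesRegularity.NavierStokesRegularity.Theorems.EulerZoomLiouvillePowerGaugeEulerLiouvilleSelfSimilarBernoulliSqueezeSharp
import Summits.NavierStokesRegularity.NavierStokesRegularity.Theorems.EulerZoomLiouvillePowerGaugeEulerLiouvilleSelfSimilarBernoulliSqueezeVortical
import HarnessLib

/-!
# «SUPER-FAST VORTICAL CHANNELS SQUEEZE VOLUME TOO FAST», member level — the binder for THE ONE STATEMENT in vortical-set form
# (crux `EulerZoomLiouville.PowerGaugeEulerLiouville` = stmt-NavierStokesRegularity-19832, line `birth`)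

Route №10 `EulerZoomLiouville` (NavierStokesRegularity); width seat ns-ezl-w5 g0.  Composition of the vortical-set squeeze
`Loc.curl_eq_zero_of_vorticalFastChannel_of_thin` (…SqueezeVortical) with the pressure bridge `WeakToClassical.pressureProfile_ae_eq_add_const` and the
`A`/`D`-gauge thinness of the high Bernoulli sets (…SqueezeSharp's route):

* **`Loc.selfSimilar_ae_eq_zero_of_vorticalSuperFastChannelC2_profile`** — crux hypotheses verbatim (`0 < ρ ≤ ½`) + exact self-similarity + `V ∈ C²` of linear
  growth `‖V y‖ ≤ K₁(1+‖y‖)` + for every classical pressure `P′` of `V`: at every far VORTICAL point of every high set `{ℋ_{P′} > h}` the channel bound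
  `⟪y, γy + V y⟫ ≤ −c₁‖y‖²`, `c₁ > 3/((2+ρ)(1+2ρ))` ⇒ `u = 0` a.e. on `(−∞,0) × ℝ³`.

Suggested skeleton predicate (LEAD's call): `HasSuperFastVorticalChannel ρ V := (∃ K₁, ∀ y, ‖V y‖ ≤ K₁(1+‖y‖)) ∧ ∃ c₁ > 3/((2+ρ)(1+2ρ)), ∀ P′,
IsSelfSimilarEulerProfile (1/(2+ρ)) 0 V P′ → ∀ h, ∃ R₀, ∀ y, R₀ ≤ ‖y‖ → h < ℋ_{P′}(y) → curl V y ≠ 0 → ⟪y, γy + V y⟫ ≤ −c₁‖y‖²`.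

HONEST LABEL: partial model-class stratum (linear growth; super-fast far vortical channels); THE ONE STATEMENT's marginal channels untouched.
WHAT THIS IS NOT: not NS, not E — a classical sub-stratum `--supports` stmt-19832 on the MODEL lattice (E/NS strata); 19832 OPEN; NS regularity NOT
proved. [folklore; ConstantinIgnatovaVicol2026Putative §3.4]
-/

noncomputable section

-- flat `Theorems/<Route><Decl>…` files of one crux share the namespace of the crux (tree convention)
set_option linter.dupNamespace false

open MeasureTheory Set Filter Topology Metric Function InnerProductSpace TopologicalSpace
open scoped RealInnerProductSpace NNReal ENNReal ContDiff

namespace Summit.NavierStokesRegularity.NavierStokesRegularity.Theorems.PowerGaugeEulerLiouville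

open Literature.Analysis Literature.Analysis.FluidPDE Literature.Analysis.FunctionSpaces

/-! ### The sharp member theorem, vortical-set form -/

/-- **EXACTLY SELF-SIMILAR MEMBERS WHOSE `C²` PROFILE OF LINEAR GROWTH HAS A SUPER-FAST FAR VORTICAL CHANNEL ARE TRIVIAL — channel bound asked only at
vortical points, no far-field pressure hypothesis**
(crux hypotheses verbatim, `0 < ρ ≤ ½`, `γ = 1/(2+ρ)`; `V ∈ C²`, `‖V y‖ ≤ K₁(1+‖y‖)`; for every classical pressure `P′` of `V`, on the far part of every
high set `{ℋ_{P′} > h}` the channel bound `⟪y, γy + V y⟫ ≤ −c₁‖y‖²`, `c₁ > 3/((2+ρ)(1+2ρ))`).  The high sets are thin with rate `1+2ρ` by the `A`- and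
`D`-gauges through the bridge `P = P′ + c₀` a.e.; then the squeeze `Loc.curl_eq_zero_of_fastChannel_of_thin` and the irrotational `C²` stratum. [folklore] -/
theorem Loc.selfSimilar_ae_eq_zero_of_vorticalSuperFastChannelC2_profile {ρ : ℝ} (hρ : 0 < ρ) (hρ1 : ρ ≤ 1 / 2)
    {u : ℝ → EuclideanSpace ℝ (Fin 3) → EuclideanSpace ℝ (Fin 3)} {p : ℝ → EuclideanSpace ℝ (Fin 3) → ℝ}
    {H : ℝ → EuclideanSpace ℝ (Fin 3) → EuclideanSpace ℝ (Fin 3) →L[ℝ] EuclideanSpace ℝ (Fin 3)} {c : ℝ≥0}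
    (hsw : IsSuitableWeakSolutionOn (slab (EuclideanSpace ℝ (Fin 3)) (Iio 0) isOpen_Iio) 0 0 u p)
    (hgauge : ∀ a : ℝ, 0 < a →
      ENNReal.ofReal (a ^ (2 * ρ)) * cknA a (0 : ℝ × EuclideanSpace ℝ (Fin 3)) u +
          ENNReal.ofReal (a ^ ρ) * cknE a (0 : ℝ × EuclideanSpace ℝ (Fin 3)) H +
        ENNReal.ofReal (a ^ (2 * ρ)) * cknD a (0 : ℝ × EuclideanSpace ℝ (Fin 3)) p ≤ (c : ℝ≥0∞))
    {V : EuclideanSpace ℝ (Fin 3) → EuclideanSpace ℝ (Fin 3)} {P : EuclideanSpace ℝ (Fin 3) → ℝ}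
    (hu : ∀ τ : ℝ, τ < 0 → u τ = selfSimilarCollapse (1 / (2 + ρ)) 0 V τ)
    (hp : ∀ τ : ℝ, τ < 0 → p τ = selfSimilarCollapsePressure (1 / (2 + ρ)) 0 P τ)
    (hV : ContDiff ℝ 2 V) {K₁ : ℝ} (hK₁ : ∀ y : EuclideanSpace ℝ (Fin 3), ‖V y‖ ≤ K₁ * (1 + ‖y‖))
    {c₁ : ℝ} (hc₁ : 3 / ((2 + ρ) * (1 + 2 * ρ)) < c₁)
    (hB : ∀ P' : EuclideanSpace ℝ (Fin 3) → ℝ, IsSelfSimilarEulerProfile (1 / (2 + ρ)) 0 V P' →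
      ∀ h : ℝ, ∃ R₀ : ℝ, ∀ y : EuclideanSpace ℝ (Fin 3), R₀ ≤ ‖y‖ →
        h < selfSimilarBernoulli (1 / (2 + ρ)) 0 V P' y → curl V y ≠ 0 →
          ⟪y, selfSimilarTransport (1 / (2 + ρ)) 0 V y⟫ ≤ -(c₁ * ‖y‖ ^ 2)) :
    uncurry u =ᵐ[volume.restrict (Iio (0 : ℝ) ×ˢ (univ : Set (EuclideanSpace ℝ (Fin 3))))] 0 := by
  -- adapted from `Loc.selfSimilar_ae_eq_zero_of_superFastChannelC2_profile` (…SelfSimilarBernoulliSqueezeSharp)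
  have hρ1' : ρ < 1 := by linarith
  have h2ρ : (0 : ℝ) < 2 + ρ := by linarith
  have hγ : (0 : ℝ) < 1 / (2 + ρ) := one_div_pos.2 h2ρ
  have hγ2 : 1 / (2 + ρ) < 1 / 2 := one_div_lt_one_div_of_lt two_pos (by linarith)
  have hA : ∀ a : ℝ, 0 < a → ENNReal.ofReal (a ^ (2 * ρ)) *
      cknA a (0 : ℝ × EuclideanSpace ℝ (Fin 3)) u ≤ (c : ℝ≥0∞) :=
    fun a ha => le_trans (le_trans le_self_add le_self_add) (hgauge a ha)
  have hD : ∀ a : ℝ, 0 < a → ENNReal.ofReal (a ^ (2 * ρ)) *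
      cknD a (0 : ℝ × EuclideanSpace ℝ (Fin 3)) p ≤ (c : ℝ≥0∞) :=
    fun a ha => le_trans le_add_self (hgauge a ha)
  have hum : AEStronglyMeasurable (uncurry u)
      (volume.restrict (Iio (0 : ℝ) ×ˢ (univ : Set (EuclideanSpace ℝ (Fin 3))))) := by
    have := hsw.distributional.1.aestronglyMeasurable
    simpa [slab] using this
  have hpm : AEStronglyMeasurable (uncurry p)
      (volume.restrict (Iio (0 : ℝ) ×ˢ (univ : Set (EuclideanSpace ℝ (Fin 3))))) := by
    have := hsw.distributional.2.2.1.aestronglyMeasurable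
    simpa [slab] using this
  have hVm : AEStronglyMeasurable V volume := aestronglyMeasurable_profile hum hu
  have hPm := aestronglyMeasurable_pressureProfile hpm hp
  have hDprof := profile_pressure_weight_of_gaugeD hρ hρ1' hpm hp hD
  have hP1 : LocallyIntegrable P volume :=
    EnergySaturation.locallyIntegrable_pressure_of_weight hρ1' hPm
      (ENNReal.mul_ne_top ENNReal.ofReal_ne_top ENNReal.coe_ne_top) hDprof
  have hAprof := profile_energy_growth_of_gaugeA hρ hu hA
  obtain ⟨P', hprof⟩ := WeakToClassical.exists_isSelfSimilarEulerProfile_of_contDiff hsw.distributional hu hp hV hP1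
  have hfast := hB P' hprof
  -- the bridge: `P = P' + c₀` a.e.
  obtain ⟨c₀, hc₀⟩ := WeakToClassical.pressureProfile_ae_eq_add_const hsw.distributional hu hp hV hP1 hprof
  -- thinness of the high sets of `ℋ_P` from the `A`- and `D`-gauges (sz-p1)
  have hD' : ∫⁻ y, ‖P y‖ₑ ^ (3 / 2 : ℝ) * ENNReal.ofReal (‖y‖ ^ (2 * ρ - 2)) ≤
      ENNReal.ofReal ((2 - 2 * ρ) / (2 + ρ) * (c : ℝ)) := by
    refine hDprof.trans (le_of_eq ?_)
    rw [ENNReal.ofReal_mul (by apply div_nonneg <;> linarith), ENNReal.ofReal_coe_nnreal]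
  -- transfer to the high sets of `ℋ_{P'}` (a.e. equal up to the level shift `c₀`)
  have hthin : ∀ h : ℝ, ∃ C R₂ : ℝ, 0 < R₂ ∧ ∀ R : ℝ, R₂ ≤ R →
      volume ({y : EuclideanSpace ℝ (Fin 3) | h < selfSimilarBernoulli (1 / (2 + ρ)) 0 V P' y} ∩ {y | R ≤ ‖y‖}) ≤
        ENNReal.ofReal (C * R ^ (-(1 + 2 * ρ))) := by
    intro h
    obtain ⟨C'', L₀, hL₀, hfar⟩ :=
      BernoulliThinness.volume_bernoulliHigh_inter_far_le hρ hρ1' hVm hAprof hPm hD' (h + c₀)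
    refine ⟨C'', L₀, hL₀, fun R hR => ?_⟩
    have hae : ∀ᵐ y ∂(volume : Measure (EuclideanSpace ℝ (Fin 3))),
        y ∈ ({y : EuclideanSpace ℝ (Fin 3) | h < selfSimilarBernoulli (1 / (2 + ρ)) 0 V P' y} ∩ {y | R ≤ ‖y‖}) →
          y ∈ ({y : EuclideanSpace ℝ (Fin 3) | h + c₀ < selfSimilarBernoulli (1 / (2 + ρ)) 0 V P y} ∩ {y | R ≤ ‖y‖}) := by
      filter_upwards [hc₀] with y hy
      rintro ⟨h1, h2⟩
      refine ⟨?_, h2⟩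
      simp only [mem_setOf_eq, selfSimilarBernoulli_apply] at h1 ⊢
      rw [hy]
      linarith
    refine (measure_mono_ae hae).trans ?_
    rw [show -(1 + 2 * ρ) = -1 - 2 * ρ by ring]
    exact hfar R hR
  have hrace : 3 * (1 / (2 + ρ)) < c₁ * (1 + 2 * ρ) := by
    have h12 : (0 : ℝ) < 1 + 2 * ρ := by linarith
    have h1 := (div_lt_iff₀ (by positivity : (0 : ℝ) < (2 + ρ) * (1 + 2 * ρ))).1 hc₁
    rw [show 3 * (1 / (2 + ρ)) = 3 / (2 + ρ) by ring, div_lt_iff₀ h2ρ]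
    nlinarith
  have hc₁0 : 0 < c₁ := lt_trans (by positivity) hc₁
  have hcurl : ∀ x, curl V x = 0 := fun x =>
    Loc.curl_eq_zero_of_vorticalFastChannel_of_thin hprof hγ hγ2 hK₁ hc₁0 hrace hthin hfast x
  exact Loc.selfSimilar_ae_eq_zero_of_irrotationalC2_profile hρ hsw.distributional hA hu hV hcurl

end Summit.NavierStokesRegularity.NavierStokesRegularity.Theorems.PowerGaugeEulerLiouville

end
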